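import Summits.Ventures.CertifiedManyBodySolver.Certificates.HubbardSquare_n1_obliqueStation_xl1_readers
import Summits.Ventures.CertifiedManyBodySolver.Certificates.HubbardSquare_U5_n1_tp1o2_lower_row803
import HarnessLib
import HarnessLib.Audit

/-!
# Ventures/CertifiedManyBodySolver — Certificates/HubbardSquare_n1_obliqueStation_xl1_K5_byName_discharge.lean

HONEST FRAMING: BOOKKEEPING ONLY — the BY-VALUE hypothesis `hK5p50n1` of C-175 (hubbard-fast-reuse-2 g22, (N32) «n = 1 OBLIQUE STATION, K-R1′ key
(5, 1, ±1/2)», word modules `Certificates/HubbardSquare_n1_stiffness_obliqueStation_xl1K5_*.lean`, readers §4 of `…_xl1_readers.lean`, TREE spelling of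
record shared with unc-2 / box-eng-2 C-174) is discharged BY NAME on the landed claim node of CERTIFIED #803 (5, 1, +1/2) e₀ LOWER (sr-mbsolver registry;
lit-4 module `HubbardSquare_U5_n1_tp1o2_lower_row803.lean`, node `cert_r803_bs_GU5n1tp1o2_w3_b4_R2_ob5p2_kry1_kry2c3rel_hanK7B4D4_KN4_PR20d4_hanK8c2s_uprime : Prop := ((-507860049846727520828011/604462909807314587353088 : ℚ) : ℝ) ≤ energyDensityTT' 1 (1/2) 5 1`), letter for letter — so every C-174 / C-175 binding of `hK5p50n1`
is BY NAME on #803 from this file on (the C-134 / #648 and C-145 / #681 / #683 pattern). The `t′ = −1/2` copy follows by evenness at half filling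
(`n1_xl1_floor_K5m_of_v`). No word, no numeral of ours, no new claim node, no definition, no `sorry`; not a registry row; no summit statement is proved by this seat.
-/

noncomputable section

namespace Summit.Ventures.CertifiedManyBodySolver.Certificates

open Literature.MathematicalPhysics.QuantumLattice
open Literature.MathematicalPhysics.QuantumLattice.ThermodynamicLimit

/-- `hK5p50n1` BY NAME: the claim node of CERTIFIED #803 gives `−507860049846727520828011/2⁷⁹ ≤ e(1, +1/2, 5, 1)` (letter for letter). [cite: Griffiths1966, §II] -/
theorem n1_xl1_hK5p50n1_of_node (h : cert_r803_bs_GU5n1tp1o2_w3_b4_R2_ob5p2_kry1_kry2c3rel_hanK7B4D4_KN4_PR20d4_hanK8c2s_uprime) :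
    (((-507860049846727520828011/604462909807314587353088 : ℚ)) : ℝ) ≤ energyDensityTT' 1 (1 / 2) 5 1 := h

/-- The same row read at `t′ = −1/2` BY NAME (evenness at half filling, `n1_xl1_floor_K5m_of_v`). [cite: LiebWuPhysicaA2003, §1 eq. (3)] -/
theorem n1_xl1_floor_K5m_of_node (h : cert_r803_bs_GU5n1tp1o2_w3_b4_R2_ob5p2_kry1_kry2c3rel_hanK7B4D4_KN4_PR20d4_hanK8c2s_uprime) :
    (((-507860049846727520828011/604462909807314587353088 : ℚ)) : ℝ) ≤ energyDensityTT' 1 (-1/2) 5 1 :=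
  n1_xl1_floor_K5m_of_v (n1_xl1_hK5p50n1_of_node h)

end Summit.Ventures.CertifiedManyBodySolver.Certificates

end
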